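import Literature.Algebra.EuclideanLattices.KhotSVPHardness
import Literature.Computability.Complexity.GapSetCover
import Literature.Computability.Complexity.SatUnsatPromiseHard
import HarnessLib

/-!
# Khot 2005, Thm. 1.1 (constant factors, `ℓ₂`): the complexity-theoretic assembly down to the gap set cover reduction

Topic `Algebra/EuclideanLattices`, namespace `Literature.Algebra.EuclideanLattices`. A brick of the
decomposition of the named fact `gapSVP_const_isNPHardRandomized` (`LatticeComplexity.lean`, pqc.S17:
for every constant `γ₀ ≥ 1`, `GapSVP_{γ₀}` is NP-hard under randomised two-sided-error reductions)
through `Khot2005_SAT_randReducible_gapSVP` (`KhotSVPHardness.lean`). Khot's printed proof (J. ACM 52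
(2005), §7.3) is the chain SAT →(Thm. 3.1: "The reduction is from Exact Set Cover. It is known
that, for any constant `η > 0`, there is a polynomial-time reduction from SAT to the Set Cover
problem …" = Arora–Babai–Stern–Sweedyk 1997, Prop. 6, the named fact `AroraEtAl1997_prop6` of
`GapSetCover.lean`) gap exact set cover →(Thm. 5.1, §§6–7, randomised) `GapSVP`. This file PROVES
the complexity-theoretic composition of that chain, so that the two named facts above are reduced
to `AroraEtAl1997_prop6` plus ONE statement about Khot's own map — a randomised polynomial-time
reduction from `gapSetCover c` (some `c > 1`; the landed mathematics `Khot.khot_gap_instances`,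
`KhotParameters.lean`, is for `c = 40`) to `gapSVPPromise γ₀`:

* `promiseRandReducible_satUnsat_gapSVP_of_gapSetCover` — `AroraEtAl1997_prop6` (Karp:
  `(SAT, UNSAT) → gapSetCover c`) followed by a randomised reduction `gapSetCover c → GapSVP_γ` is a
  randomised reduction `(SAT, UNSAT) → GapSVP_γ` (`PromiseRandReducible.of_polyTimeReducible_left`);
* `promiseRandReducible_SAT_gapSVP_of_gapSetCover` — the same from `ofLanguage SAT` (the source of
  `Khot2005_SAT_randReducible_gapSVP`), through the Karp equivalence `ofLanguage SAT ⇆ (SAT, UNSAT)`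
  (`ofLanguage_SAT_polyTimeReducible_satUnsatPromise`, `SatUnsatPromiseHard.lean`: non-codewords to
  a fixed unsatisfiable code);
* `Khot2005_SAT_randReducible_gapSVP_of_gapSetCover`, `…_of_gapSetCover_frequently` (an unbounded
  set of constants `γ` suffices, `khot2005_SAT_randReducible_gapSVP_iff`),
  `gapSVP_const_isNPHardRandomized_of_gapSetCover` (the target fact), and the direct route
  `isNPHardRandomized_of_promiseRandReducible_gapSetCover` through NP-hardness of `(SAT, UNSAT)`
  (`satUnsatPromise_isNPHard`, Cook–Levin) that does not pass through `ofLanguage SAT`.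

## What remains for `gapSVP_const_isNPHardRandomized_holds`

(i) `AroraEtAl1997_prop6` (PCP theorem + Bellare–Goldwasser–Lund–Russell 1993; a named fact, not
proved in the tree); (ii) the hypothesis `hKhot` below for one `c > 1` and every `γ₀ ≥ 1`:
`PromiseRandReducible (gapSetCover c) (gapSVPPromise fun _ => γ₀)` — by
`promiseRandReducible_of_cnt` (`MetaComplexity/PromiseRandReductionsCounting.lean`) this is an `FP`
string function `F` on pair codes `⟨x, r⟩` with a polynomial coin budget whose good coin strings are
counted by `Khot.khot_gap_instances` (`KhotParameters.lean`, `c = 40`, error `≤ 2/100`) once `F ⟨code I, r⟩`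
is the `gapSVPInstanceEncoding`-code of `Khot.khotInstance …` read off `r` through an equal-fibre
decoder (`uniformProb_setOf_comp_eq`), non-codes and `K = 0` being sent to fixed instances. That
machine-level statement (Khot 2005, Thm. 5.1 (1): "The reduction runs in time polynomial in `N`";
§7.3: "a reduction that runs in time `n^{O(k²)}`") is the only non-PCP content still open.

## References

* S. Khot, *Hardness of approximating the shortest vector problem in lattices*, J. ACM 52 (2005)
  789–808: Thm. 1.1, Thm. 3.1 (proof, first paragraph), Thm. 5.1 (1), §7.3.
* S. Arora, L. Babai, J. Stern, Z. Sweedyk, *The hardness of approximate optima in lattices, codes,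
  and systems of linear equations*, J. Comput. Syst. Sci. 54 (1997) 317–331, Prop. 6.
* S. Arora, B. Barak, *Computational Complexity: A Modern Approach*, CUP 2009, Lemma 2.11, Thm. 2.8,
  Def. 7.16 and §7.6.
-/

noncomputable section

namespace Literature.Algebra.EuclideanLattices

open Computability Literature.Computability.Complexity Literature.Computability.MetaComplexity
  Literature.Computability.Complexity.PromiseProblem

/-! ### From a randomised reduction of gap set cover to `GapSVP` -/

/-- **`(SAT, UNSAT) → GapSVP_γ`, randomised, from the PCP-based Karp reduction to gap exact set
cover** (`AroraEtAl1997_prop6`, Khot's Thm. 3.1 input) **and a randomised reduction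
`gapSetCover c → GapSVP_γ`** (Khot's Thm. 5.1 with §§6–7): Karp then randomised is randomised
(`PromiseRandReducible.of_polyTimeReducible_left`). [cite: Khot2005, Thm. 3.1 and §7.3] -/
theorem promiseRandReducible_satUnsat_gapSVP_of_gapSetCover (hPCP : AroraEtAl1997_prop6) {c : ℚ}
    (hc : 1 < c) {γ : ℕ → ℝ} (h : PromiseRandReducible (gapSetCover c) (gapSVPPromise γ)) :
    PromiseRandReducible satUnsatPromise (gapSVPPromise γ) :=
  PromiseRandReducible.of_polyTimeReducible_left (hPCP c hc) h

/-- The same reduction from `ofLanguage SAT` (NO = all strings outside `SAT`): precompose with the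
Karp reduction `ofLanguage SAT → (SAT, UNSAT)` sending non-codewords to a fixed unsatisfiable code
(`ofLanguage_SAT_polyTimeReducible_satUnsatPromise`). [cite: Khot2005, Thm. 3.1 and §7.3] -/
theorem promiseRandReducible_SAT_gapSVP_of_gapSetCover (hPCP : AroraEtAl1997_prop6) {c : ℚ}
    (hc : 1 < c) {γ : ℕ → ℝ} (h : PromiseRandReducible (gapSetCover c) (gapSVPPromise γ)) :
    PromiseRandReducible (ofLanguage SAT) (gapSVPPromise γ) :=
  PromiseRandReducible.of_polyTimeReducible_left ofLanguage_SAT_polyTimeReducible_satUnsatPromise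
    (promiseRandReducible_satUnsat_gapSVP_of_gapSetCover hPCP hc h)

/-- **Khot's fact from the gap set cover reduction.** `Khot2005_SAT_randReducible_gapSVP` (for every
constant `γ₀ ≥ 1`, a randomised reduction `ofLanguage SAT → GapSVP_{γ₀}`) follows from
`AroraEtAl1997_prop6` and, for every `γ₀ ≥ 1`, a randomised reduction `gapSetCover c → GapSVP_{γ₀}`
for some `c > 1` (Khot: `c = 1/η`). [cite: Khot2005, Thm. 1.1 and §7.3] -/
theorem Khot2005_SAT_randReducible_gapSVP_of_gapSetCover (hPCP : AroraEtAl1997_prop6)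
    (hKhot : ∀ γ₀ : ℝ, 1 ≤ γ₀ →
      ∃ c : ℚ, 1 < c ∧ PromiseRandReducible (gapSetCover c) (gapSVPPromise fun _ => γ₀)) :
    Khot2005_SAT_randReducible_gapSVP := fun γ₀ hγ₀ => by
  obtain ⟨c, hc, h⟩ := hKhot γ₀ hγ₀
  exact promiseRandReducible_SAT_gapSVP_of_gapSetCover hPCP hc h

/-- The same with the weakest useful hypothesis: reductions `gapSetCover c → GapSVP_γ` for an
UNBOUNDED set of constants `γ` ("choosing `k` to be a large enough constant, we prove an arbitrarily
large constant factor hardness", §7.3; `khot2005_SAT_randReducible_gapSVP_iff`).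
[cite: Khot2005, §7.3] -/
theorem Khot2005_SAT_randReducible_gapSVP_of_gapSetCover_frequently (hPCP : AroraEtAl1997_prop6)
    (hKhot : ∀ γ₀ : ℝ, ∃ γ : ℝ, γ₀ ≤ γ ∧
      ∃ c : ℚ, 1 < c ∧ PromiseRandReducible (gapSetCover c) (gapSVPPromise fun _ => γ)) :
    Khot2005_SAT_randReducible_gapSVP := by
  refine khot2005_SAT_randReducible_gapSVP_iff.2 fun γ₀ => ?_
  obtain ⟨γ, hγ, c, hc, h⟩ := hKhot γ₀
  exact ⟨γ, hγ, promiseRandReducible_SAT_gapSVP_of_gapSetCover hPCP hc h⟩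

/-- **The target fact from the gap set cover reduction.** `gapSVP_const_isNPHardRandomized`
(pqc.S17) follows from `AroraEtAl1997_prop6` and the randomised reductions `gapSetCover c → GapSVP_{γ₀}`
(`gapSVP_const_isNPHardRandomized_of_SAT_randReducible`: Cook–Levin and composition, both proved).
[cite: Khot2005, Thm. 1.1 and §7.3] -/
theorem gapSVP_const_isNPHardRandomized_of_gapSetCover (hPCP : AroraEtAl1997_prop6)
    (hKhot : ∀ γ₀ : ℝ, 1 ≤ γ₀ →
      ∃ c : ℚ, 1 < c ∧ PromiseRandReducible (gapSetCover c) (gapSVPPromise fun _ => γ₀)) :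
    gapSVP_const_isNPHardRandomized :=
  gapSVP_const_isNPHardRandomized_of_SAT_randReducible
    (Khot2005_SAT_randReducible_gapSVP_of_gapSetCover hPCP hKhot)

/-- The target fact with the constant `c = 40` of the landed mathematics (`Khot.khot_gap_instances`:
exact cover by `K` sets vs. no cover by `< 40K` sets, `η = 1/40`). [cite: Khot2005, Thm. 1.1 and §7.3] -/
theorem gapSVP_const_isNPHardRandomized_of_gapSetCover_forty (hPCP : AroraEtAl1997_prop6)
    (hKhot : ∀ γ₀ : ℝ, 1 ≤ γ₀ → PromiseRandReducible (gapSetCover 40) (gapSVPPromise fun _ => γ₀)) :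
    gapSVP_const_isNPHardRandomized :=
  gapSVP_const_isNPHardRandomized_of_gapSetCover hPCP fun γ₀ hγ₀ => ⟨40, by norm_num, hKhot γ₀ hγ₀⟩

/-! ### The direct route through NP-hardness of `(SAT, UNSAT)` -/

/-- **Every promise problem to which `(SAT, UNSAT)` randomly reduces is NP-hard under randomised
reductions** (`satUnsatPromise_isNPHard` — the Cook–Levin reduction lands in CNF codes — and
`IsHard.isRandHard_of_promiseRandReducible`). [cite: AroraBarak2009, Lemma 2.11 and §7.6] -/
theorem isNPHardRandomized_of_promiseRandReducible_satUnsat {Q : PromiseProblem}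
    (h : PromiseRandReducible satUnsatPromise Q) : Q.IsNPHardRandomized :=
  IsHard.isRandHard_of_promiseRandReducible satUnsatPromise_isNPHard h

/-- **Every promise problem to which gap exact set cover randomly reduces is NP-hard under
randomised reductions**, given `AroraEtAl1997_prop6`. [cite: AroraEtAl1997, Prop. 6 (p. 319)] -/
theorem isNPHardRandomized_of_promiseRandReducible_gapSetCover (hPCP : AroraEtAl1997_prop6) {c : ℚ}
    (hc : 1 < c) {Q : PromiseProblem} (h : PromiseRandReducible (gapSetCover c) Q) :
    Q.IsNPHardRandomized :=
  isNPHardRandomized_of_promiseRandReducible_satUnsat (PromiseRandReducible.of_polyTimeReducible_left (hPCP c hc) h)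

/-- Pointwise form of the target: randomised NP-hardness of one `GapSVP_γ` from one randomised
reduction `gapSetCover c → GapSVP_γ` and `AroraEtAl1997_prop6`. [cite: Khot2005, Thm. 1.1] -/
theorem isNPHardRandomized_gapSVP_of_gapSetCover (hPCP : AroraEtAl1997_prop6) {c : ℚ} (hc : 1 < c)
    {γ : ℕ → ℝ} (h : PromiseRandReducible (gapSetCover c) (gapSVPPromise γ)) :
    (gapSVPPromise γ).IsNPHardRandomized :=
  isNPHardRandomized_of_promiseRandReducible_gapSetCover hPCP hc h

end Literature.Algebra.EuclideanLattices
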